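/-
Copyright (c) 2026. All rights reserved.
Released under Apache 2.0 license as described in the file LICENSE.
-/
import Mathlib.Topology.Compactification.OnePoint.Sphere
import Literature.AlgebraicTopology.SingularHomology.SphereHomology
import Literature.AlgebraicTopology.SingularHomology.UniversalCoefficientsField
import Literature.AlgebraicTopology.SingularHomology.CapProduct

/-!
# The cylinder on a sphere: `Hᵏ(Sᵏ × ℝʲ; F)` is one-dimensional, and Kronecker-duality lemmas

Elementary consequences of results already in the tree (Hatcher 2002, Cor. 2.11, Cor. 2.14,
Thm. 3.2), packaged for the rigidity theorem for natural endomorphisms of `Hᵏ(-; ℂ)` on smooth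
manifolds (`Literature.Geometry.Manifold.NaturalCohomologyEndo`):

* `onePointHomeomorphUnitSphere k : OnePoint ℝᵏ ≃ₜ Sᵏ` (Mathlib's `onePointEquivSphereOfFinrankEq`);
* `sphereCylinderHomotopyEquiv k j : Sᵏ × ℝʲ ≃ₕ Sᵏ` (projection / zero section, straight-line
  homotopy), hence `(q ↦ (q, 0))_*` is injective on `Hₙ` and
  `finrank_singularCohomology_sphereCylinder : dim_F Hᵏ(Sᵏ × ℝʲ; F) = 1` for `k ≥ 1`
  (`Hₖ(Sᵏ; F) ≅ F`, Hatcher Cor. 2.14, and universal coefficients over a field, Thm. 3.2);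
* over a field: a non-zero homology class is detected by some cohomology class
  (`exists_kroneckerPairing_ne_zero`), `Hⁿ = 0` when `Hₙ = 0`
  (`singularCohomology_eq_zero_of_subsingleton`), a subspace of `Hⁿ(X; F)` whose Kronecker
  annihilator in the finite-dimensional `Hₙ(X; F)` is trivial is everything
  (`submodule_eq_top_of_kroneckerPairing`), and an endomorphism of a one-dimensional space is a
  scalar (`exists_apply_eq_smul_of_finrank_eq_one`).

## References
* [HatcherAT2002] A. Hatcher, *Algebraic Topology*, CUP 2002, Cor. 2.11, Cor. 2.14, §3.1 Thm. 3.2.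
-/

noncomputable section

open CategoryTheory Set Function

namespace Literature.AlgebraicTopology.SingularHomology

universe u v

/-! ### Linear algebra over a field around the Kronecker pairing -/

section Field

variable (F : Type v) [Field F] {X : Type u} [TopologicalSpace X]

/-- Over a field, a non-zero class `τ ∈ Hₙ(X; F)` is detected by a cohomology class:
`⟨v, τ⟩ ≠ 0` for some `v ∈ Hⁿ(X; F)` (Hatcher 2002, Thm. 3.2: `Hⁿ(X; F) → Hom(Hₙ(X; F), F)` is
onto, and linear functionals separate points). [cite: HatcherAT2002, §3.1 Thm. 3.2 (p. 195) and p. 198] -/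
theorem exists_kroneckerPairing_ne_zero (n : ℕ) {τ : singularHomology F F X n} (hτ : τ ≠ 0) :
    ∃ v : singularCohomology F F X n, kroneckerPairing F F X n v τ ≠ 0 := by
  obtain ⟨φ, hφ⟩ : ∃ φ : Module.Dual F (singularHomology F F X n), φ τ ≠ 0 := by
    by_contra! h
    exact hτ ((Module.forall_dual_apply_eq_zero_iff F τ).1 h)
  obtain ⟨v, rfl⟩ := (kroneckerPairing_bijective_of_field F X n).2 φ
  exact ⟨v, hφ⟩

/-- Over a field, `Hⁿ(X; F) = 0` when `Hₙ(X; F) = 0` (Hatcher 2002, Thm. 3.2: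
`Hⁿ(X; F) ≅ Hom(Hₙ(X; F), F)`). [cite: HatcherAT2002, §3.1 Thm. 3.2 (p. 195) and p. 198] -/
theorem singularCohomology_eq_zero_of_subsingleton (n : ℕ)
    [Subsingleton (singularHomology F F X n)] (x : singularCohomology F F X n) : x = 0 :=
  (kroneckerPairing_bijective_of_field F X n).1 (Subsingleton.elim _ _)

/-- Over a field and with `Hₙ(X; F)` finite-dimensional, a subspace `S ≤ Hⁿ(X; F)` whose
Kronecker annihilator in `Hₙ(X; F)` is trivial is all of `Hⁿ(X; F)` (Hatcher 2002, Thm. 3.2: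
`Hⁿ ≅ (Hₙ)^*`, and a finite-dimensional space is reflexive). [cite: HatcherAT2002, §3.1 Thm. 3.2 (p. 195) and p. 198] -/
theorem submodule_eq_top_of_kroneckerPairing (n : ℕ) [Module.Finite F (singularHomology F F X n)]
    (S : Submodule F (singularCohomology F F X n))
    (hS : ∀ σ : singularHomology F F X n, (∀ s ∈ S, kroneckerPairing F F X n s σ = 0) → σ = 0) :
    S = ⊤ := by
  by_contra hne
  obtain ⟨φ, hφ0, hSφ⟩ := Submodule.exists_le_ker_of_lt_top S (lt_top_iff_ne_top.2 hne)
  let κ := LinearEquiv.ofBijective _ (kroneckerPairing_bijective_of_field F X n)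
  let Φ : Module.Dual F (Module.Dual F (singularHomology F F X n)) := φ ∘ₗ κ.symm.toLinearMap
  let σ : singularHomology F F X n := (Module.evalEquiv F (singularHomology F F X n)).symm Φ
  have hσ : ∀ ψ : Module.Dual F (singularHomology F F X n), ψ σ = Φ ψ := fun ψ ↦ by
    have h : (Module.evalEquiv F (singularHomology F F X n) σ) ψ = Φ ψ := by
      simp only [σ, LinearEquiv.apply_symm_apply]
    rwa [Module.evalEquiv_apply, Module.Dual.eval_apply] at h
  have hσ0 : σ = 0 := hS σ fun s hs ↦ by
    have h1 : kroneckerPairing F F X n s σ = Φ (κ s) := hσ (κ s)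
    rw [h1]
    change φ (κ.symm (κ s)) = 0
    rw [κ.symm_apply_apply]
    exact LinearMap.mem_ker.1 (hSφ hs)
  apply hφ0
  apply LinearMap.ext
  intro v
  have h2 : φ v = Φ (κ v) := by
    change φ v = φ (κ.symm (κ v))
    rw [κ.symm_apply_apply]
  rw [h2, ← hσ (κ v), hσ0, map_zero, LinearMap.zero_apply]

omit [TopologicalSpace X] in
/-- An endomorphism of a one-dimensional vector space is a scalar. [folklore] -/
theorem exists_apply_eq_smul_of_finrank_eq_one {V : Type*} [AddCommGroup V] [Module F V]
    (h : Module.finrank F V = 1) (ψ : V →ₗ[F] V) : ∃ r : F, ∀ v : V, ψ v = r • v := by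
  obtain ⟨v₀, hv₀, hspan⟩ := finrank_eq_one_iff'.1 h
  obtain ⟨r, hr⟩ := hspan (ψ v₀)
  refine ⟨r, fun v ↦ ?_⟩
  obtain ⟨c, rfl⟩ := hspan v
  rw [map_smul, ← hr, smul_comm]

end Field

/-! ### The sphere and the cylinder on it -/

section Sphere

/-- **`OnePoint ℝᵏ ≃ₜ Sᵏ`**: the one-point compactification of `ℝᵏ` is the unit `k`-sphere of
`ℝᵏ⁺¹` (Mathlib's `onePointEquivSphereOfFinrankEq`, inverse stereographic projection). [folklore] -/
def onePointHomeomorphUnitSphere (k : ℕ) :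
    OnePoint (EuclideanSpace ℝ (Fin k)) ≃ₜ ↥(unitSphere (k + 1)) :=
  onePointEquivSphereOfFinrankEq (by rw [finrank_euclideanSpace_fin, Fintype.card_fin])

variable (F : Type v) [Field F]

/-- **`dim_F Hₖ(Sᵏ; F) = 1`** for `k ≥ 1` (Hatcher 2002, Cor. 2.14: `Hₖ(Sᵏ; F) ≅ F`). [cite: HatcherAT2002, Cor. 2.14] -/
theorem finrank_singularHomology_unitSphere (k : ℕ) (hk : 1 ≤ k) :
    Module.finrank F (singularHomology F F ↥(unitSphere (k + 1)) k) = 1 := by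
  rw [(singularHomologyUnitSphereIso F F k hk).toLinearEquiv.finrank_eq]
  exact Module.finrank_self F

variable (R : Type v) [CommRing R] (M : Type v) [AddCommGroup M] [Module R M]

/-- The zero section `Sᵏ → Sᵏ × ℝʲ`, `q ↦ (q, 0)`. [folklore] -/
def sphereCylinderIncl (k j : ℕ) :
    C(↥(unitSphere (k + 1)), ↥(unitSphere (k + 1)) × EuclideanSpace ℝ (Fin j)) :=
  (ContinuousMap.id _).prodMk (ContinuousMap.const _ 0)

/-- `sphereCylinderIncl k j q = (q, 0)`. [folklore] -/
@[simp]
theorem sphereCylinderIncl_apply (k j : ℕ) (q : ↥(unitSphere (k + 1))) :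
    sphereCylinderIncl k j q = (q, 0) :=
  rfl

/-- **`Sᵏ × ℝʲ ≃ₕ Sᵏ`** by the projection and the zero section; `(q, v) ↦ (q, t • v)` is the
homotopy from the composite `(q, v) ↦ (q, 0)` to the identity (Hatcher 2002, Ch. 0,
deformation retraction onto a factor). [folklore] -/
def sphereCylinderHomotopyEquiv (k j : ℕ) :
    ContinuousMap.HomotopyEquiv (↥(unitSphere (k + 1)) × EuclideanSpace ℝ (Fin j))
      ↥(unitSphere (k + 1)) where
  toFun := ContinuousMap.fst
  invFun := sphereCylinderIncl k j
  left_inv :=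
    ⟨{ toFun := fun tx => (tx.2.1, (tx.1 : ℝ) • tx.2.2)
       continuous_toFun := by fun_prop
       map_zero_left := fun x => by simp
       map_one_left := fun x => by simp }⟩
  right_inv := ContinuousMap.Homotopic.refl _

/-- The zero section `q ↦ (q, 0)` is injective on `Hₙ(-; M)`: the projection is a left inverse
(Hatcher 2002, §2.1, functoriality). [folklore] -/
theorem injective_map_sphereCylinderIncl (k j n : ℕ) :
    Injective (singularHomology.map R M (sphereCylinderIncl k j) n) := by
  have h : singularHomology.map R M (sphereCylinderIncl k j) n ≫
      singularHomology.map R M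
        (ContinuousMap.fst : C(↥(unitSphere (k + 1)) × EuclideanSpace ℝ (Fin j), ↥(unitSphere (k + 1)))) n =
      𝟙 _ := by
    rw [← singularHomology.map_comp]
    exact singularHomology.map_id R M n
  intro a b hab
  have := LinearMap.congr_fun (congrArg ModuleCat.Hom.hom h) a
  have hb := LinearMap.congr_fun (congrArg ModuleCat.Hom.hom h) b
  simp only [ModuleCat.hom_comp, LinearMap.coe_comp, Function.comp_apply, ModuleCat.hom_id,
    LinearMap.id_apply] at this hb
  rw [← this, ← hb]
  exact congrArg _ hab

/-- **`b_k(Sᵏ × ℝʲ; F) = 1`** for `k ≥ 1` (homotopy invariance, Hatcher 2002, Cor. 2.11, and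
Cor. 2.14). [cite: HatcherAT2002, Cor. 2.11 and Cor. 2.14] -/
theorem finrank_singularHomology_sphereCylinder (k j : ℕ) (hk : 1 ≤ k) :
    Module.finrank F (singularHomology F F (↥(unitSphere (k + 1)) × EuclideanSpace ℝ (Fin j)) k) = 1 := by
  rw [(singularHomology.isoOfHomotopyEquiv F F (sphereCylinderHomotopyEquiv k j) k).toLinearEquiv.finrank_eq]
  exact finrank_singularHomology_unitSphere F k hk

/-- **`dim_F Hᵏ(Sᵏ × ℝʲ; F) = 1`** for `k ≥ 1` and a field `F` (universal coefficients over a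
field, Hatcher 2002, Thm. 3.2, with `b_k = 1`). [cite: HatcherAT2002, §3.1 Thm. 3.2 and Cor. 2.14] -/
theorem finrank_singularCohomology_sphereCylinder (k j : ℕ) (hk : 1 ≤ k) :
    Module.finrank F (singularCohomology F F (↥(unitSphere (k + 1)) × EuclideanSpace ℝ (Fin j)) k) = 1 := by
  rw [finrank_singularCohomology_eq_bettiNumber_of_field]
  exact finrank_singularHomology_sphereCylinder F k j hk

/-- `Hₖ(Sᵏ × ℝʲ; F)` is finite-dimensional (`k ≥ 1`). [folklore] -/
theorem finite_singularHomology_sphereCylinder (k j : ℕ) (hk : 1 ≤ k) :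
    Module.Finite F (singularHomology F F (↥(unitSphere (k + 1)) × EuclideanSpace ℝ (Fin j)) k) :=
  Module.finite_of_finrank_eq_succ (finrank_singularHomology_sphereCylinder F k j hk)

/-- A homeomorphism is injective on `Hₙ(-; M)`. [folklore] -/
theorem injective_map_homeomorph {X Y : Type u} [TopologicalSpace X] [TopologicalSpace Y]
    (e : X ≃ₜ Y) (n : ℕ) :
    Injective (singularHomology.map R M (⟨e, e.continuous⟩ : C(X, Y)) n) := by
  have h : singularHomology.map R M (⟨e, e.continuous⟩ : C(X, Y)) n ≫
      singularHomology.map R M (⟨e.symm, e.symm.continuous⟩ : C(Y, X)) n = 𝟙 _ := by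
    rw [← singularHomology.map_comp]
    have hc : (⟨e.symm, e.symm.continuous⟩ : C(Y, X)).comp (⟨e, e.continuous⟩ : C(X, Y)) =
        ContinuousMap.id X := by
      ext x
      exact e.symm_apply_apply x
    rw [hc]
    exact singularHomology.map_id R M n
  intro a b hab
  have ha := LinearMap.congr_fun (congrArg ModuleCat.Hom.hom h) a
  have hb := LinearMap.congr_fun (congrArg ModuleCat.Hom.hom h) b
  simp only [ModuleCat.hom_comp, LinearMap.coe_comp, Function.comp_apply, ModuleCat.hom_id,
    LinearMap.id_apply] at ha hb
  rw [← ha, ← hb]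
  exact congrArg _ hab

/-- **Detection through the cylinder.** Let `γ : U → OnePoint ℝᵏ`, `G : U → Sᵏ` homotopic to
`θ ∘ γ` (`θ : OnePoint ℝᵏ ≃ₜ Sᵏ`), and `σ ∈ Hₖ(U; M)` with `γ_* σ ≠ 0`. Then
`(q ↦ (G q, 0))_* σ ≠ 0` in `Hₖ(Sᵏ × ℝʲ; M)` (homotopy invariance and the injectivity of `θ_*`
and of the zero section). [cite: HatcherAT2002, Cor. 2.11] -/
theorem map_sphereCylinderIncl_comp_ne_zero {U : Type} [TopologicalSpace U] {k j n : ℕ}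
    (γ : C(U, OnePoint (EuclideanSpace ℝ (Fin k)))) (G : C(U, ↥(unitSphere (k + 1))))
    (hG : G.Homotopic
      ((⟨onePointHomeomorphUnitSphere k, (onePointHomeomorphUnitSphere k).continuous⟩ :
        C(OnePoint (EuclideanSpace ℝ (Fin k)), ↥(unitSphere (k + 1)))).comp γ))
    {σ : singularHomology R M U n} (hσ : singularHomology.map R M γ n σ ≠ 0) :
    singularHomology.map R M ((sphereCylinderIncl k j).comp G) n σ ≠ 0 := by
  rw [singularHomology.map_comp, ModuleCat.comp_apply, singularHomology.map_eq_of_homotopic R M hG,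
    singularHomology.map_comp, ModuleCat.comp_apply]
  intro h
  apply hσ
  apply injective_map_homeomorph R M (onePointHomeomorphUnitSphere k) n
  apply injective_map_sphereCylinderIncl R M k j n
  rw [h, map_zero, map_zero]

end Sphere

end Literature.AlgebraicTopology.SingularHomology

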